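import Summits.Ventures.PercRepro.ProfilePointedCircuitClassesTwelveSeriesC

/-!
# PercRepro — THE SERIES-PAIR REDUCTION OF THE TWELVE-POINT STATEMENT, IV: A SERIES CLASS OF SIZE `≥ 3` DECIDES THE
STATEMENT AT EVERY POINT (p5, gen 44; `proofs/P5-GM1.md` §66 ADDENDUM 2)

* `SeriesPair.trans`: being in series is transitive (`ρ(E − a − a'') = ρ(E) − 1` from the two given pairs by
  submodularity), so three points with `{a, a'}` and `{a', a''}` series pairs are pairwise in series.
* `star_of_seriesPair_self`: the eleven-point inequality `(★)` holds with EQUALITY when `{e, f}` is itself a series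
  pair: no bi-independent `5`-set contains both, and the swap `W ↦ W − e + f` is a bijection onto the sets through `f`.
* `inCount_five_le_outCount_six_of_seriesTriple_mem`: the twelve-point statement at a point `e` INSIDE a series class
  of size `≥ 3` (the reduction along the other two points; `(★)` on `N ／ a` is the self case).
* **`inCount_five_le_outCount_six_of_seriesTriple_all`**: on every matroid with `12` points and rank `7` that has a
  series class of size `≥ 3`, `in_5(e) ≤ out_6(e)` AT EVERY POINT `e` — in the dual: a parallel class of size `≥ 3`
  anywhere decides `InOutBottomTwelve` for the whole matroid.
-/

open scoped Matroid

namespace PercRepro.Cogirth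

open Finset ThmH Skew Shadow Profile

variable {α : Type} [DecidableEq α] {N : Matroid α} [N.Finite]

section TwelveSeriesD

/-- **TRANSITIVITY OF THE SERIES RELATION**: `{a, a'}` and `{a', a''}` series pairs, `a ≠ a''` ⟹ `{a, a''}` is a series
pair (`ρ(E − a − a' − a'') ≤ ρ(E) − 2` by submodularity of the two hyperplanes, so `ρ(E − a − a'') ≤ ρ(E) − 1`). -/
theorem SeriesPair.trans {a a' a'' : α} (h : SeriesPair N a a') (h' : SeriesPair N a' a'') (haa'' : a ≠ a'') :
    SeriesPair N a a'' := by
  obtain ⟨ha, -, -, hca, hca', hser⟩ := h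
  obtain ⟨-, ha'', -, -, hca'', hser'⟩ := h'
  refine ⟨ha, ha'', haa'', hca, hca'', ?_⟩
  -- submodularity on X := E − a − a' and Y := E − a' − a''
  have hsub := rk_union_add_rk_inter_le (M := N) (((gr N).erase a).erase a') (((gr N).erase a').erase a'')
  have hU : ((gr N).erase a).erase a' ∪ ((gr N).erase a').erase a'' = (gr N).erase a' := by
    ext y
    simp only [mem_union, mem_erase]
    constructor
    · rintro (⟨h1, _, h3⟩ | ⟨_, h2, h3⟩)
      · exact ⟨h1, h3⟩
      · exact ⟨h2, h3⟩
    · rintro ⟨h1, h2⟩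
      by_cases hya : y = a
      · exact Or.inr ⟨fun h' => haa'' (hya ▸ h'), h1, h2⟩
      · exact Or.inl ⟨h1, hya, h2⟩
  have hI : ((gr N).erase a).erase a' ∩ ((gr N).erase a').erase a'' = (((gr N).erase a).erase a').erase a'' := by
    ext y
    simp only [mem_inter, mem_erase]
    constructor
    · rintro ⟨⟨h1, h2, h3⟩, h4, -⟩
      exact ⟨h4, h1, h2, h3⟩
    · rintro ⟨h4, h1, h2, h3⟩
      exact ⟨⟨h1, h2, h3⟩, h4, h1, h3⟩
  rw [hU, hI, hca'] at hsub
  -- `E − a − a'' ⊆ (E − a − a' − a'') + a'`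
  have hins : ((gr N).erase a).erase a'' ⊆ insert a' ((((gr N).erase a).erase a').erase a'') := by
    intro y hy
    rw [mem_erase, mem_erase] at hy
    rw [mem_insert]
    by_cases hya' : y = a'
    · exact Or.inl hya'
    · exact Or.inr (mem_erase.2 ⟨hy.1, mem_erase.2 ⟨hya', mem_erase.2 ⟨hy.2.1, hy.2.2⟩⟩⟩)
  have h1 := rk_mono' (M := N) hins
  have h2 := rk_insert_le (M := N) a' ((((gr N).erase a).erase a').erase a'')
  -- `ρ(E − a − a'') ≥ ρ(E − a) − 1`
  have h3 : rk N ((gr N).erase a) ≤ rk N (((gr N).erase a).erase a'') + 1 := by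
    have := rk_insert_le (M := N) a'' (((gr N).erase a).erase a'')
    rwa [insert_erase (mem_erase.2 ⟨haa''.symm, ha''⟩)] at this
  omega

/-- **`(★)` IS AN EQUALITY ON A SERIES PAIR**: on `#E = ρ(E) + 5`, if `{e, f}` is a series pair then
`in_5(e) = in_5(f)` (no bi-independent `5`-set contains both; the swap is a bijection), hence
`in_5(e) ≤ in_5(f) + thru_5({e, f})`. -/
theorem star_of_seriesPair_self {e f : α} (hn : (gr N).card = rk N (gr N) + 5) (h : SeriesPair N e f) :
    inCount N 5 e ≤ inCount N 5 f + thruCount N 5 {e, f} := by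
  have hswap := card_filter_swap_of_seriesPair h 5 (fun _ => True) (fun _ => Iff.rfl) (fun _ => Iff.rfl)
  have hL : ((biIndepSets N 5).filter (fun W => e ∈ W)).card =
      ((biIndepSets N 5).filter (fun W => (True ∧ e ∈ W) ∧ f ∉ W)).card := by
    apply congrArg Finset.card
    apply filter_congr
    intro W hW
    constructor
    · intro heW
      exact ⟨⟨trivial, heW⟩, not_mem_of_mem_biIndepSets_of_seriesPair h hn hW heW⟩
    · rintro ⟨⟨-, heW⟩, -⟩
      exact heW
  have hR : ((biIndepSets N 5).filter (fun W => (True ∧ e ∉ W) ∧ f ∈ W)).card ≤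
      ((biIndepSets N 5).filter (fun W => f ∈ W)).card := by
    apply card_le_card
    intro W hW
    rw [mem_filter] at hW ⊢
    exact ⟨hW.1, hW.2.2⟩
  unfold inCount
  rw [hL, hswap]
  exact hR.trans (Nat.le_add_right _ _)

/-- **THE TWELVE-POINT STATEMENT AT A POINT OF A SERIES CLASS OF SIZE `≥ 3`**: on `#E = 12`, `ρ(E) = 7`, if `{a, a'}`
and `{a', e}` are series pairs (`a ≠ e`), then `in_5(e) ≤ out_6(e)` — the reduction along `{a, a'}`, and `(★)` on
`N ／ a` at `(e, a')` is the self case (`{e, a'}` stays a series pair of `N ／ a`). -/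
theorem inCount_five_le_outCount_six_of_seriesTriple_mem (hn : (gr N).card = 12) (hR : rk N (gr N) = 7)
    {a a' e : α} (h : SeriesPair N a a') (h' : SeriesPair N a' e) (hae : a ≠ e) :
    inCount N 5 e ≤ outCount N 6 e := by
  have he : e ∈ gr N := h'.2.1
  have hea' : e ≠ a' := h'.2.2.1.symm
  apply inCount_five_le_outCount_six_of_seriesPair_of_star hn hR h he hae.symm hea'
  have hgr' : gr (N ／ ({a} : Set α)) = (gr N).erase a := gr_contract'
  have hind := indep_singleton_of_seriesPair h
  have hcard' : (gr (N ／ ({a} : Set α))).card = 11 := by rw [hgr', card_erase_of_mem h.1, hn]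
  have hrk' : rk (N ／ ({a} : Set α)) (gr (N ／ ({a} : Set α))) = 6 := by
    have := rk_gr_contract_add_one hind h.1
    omega
  have hpair : SeriesPair (N ／ ({a} : Set α)) e a' :=
    (seriesPair_contract_of_seriesPair h h' hae).symm
  exact star_of_seriesPair_self (by omega) hpair

/-- **A SERIES CLASS OF SIZE `≥ 3` DECIDES THE TWELVE-POINT STATEMENT AT EVERY POINT**: on `#E = 12`, `ρ(E) = 7`, if
`{a, a'}` and `{a', a''}` are series pairs with `a ≠ a''`, then `in_5(e) ≤ out_6(e)` for EVERY `e ∈ E` — outside the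
class by `inCount_five_le_outCount_six_of_seriesTriple`, inside it by `…_of_seriesTriple_mem` (with the transitivity
`SeriesPair.trans` to reorder the class around `e`). -/
theorem inCount_five_le_outCount_six_of_seriesTriple_all (hn : (gr N).card = 12) (hR : rk N (gr N) = 7)
    {a a' a'' : α} (h : SeriesPair N a a') (h' : SeriesPair N a' a'') (haa'' : a ≠ a'') {e : α} (he : e ∈ gr N) :
    inCount N 5 e ≤ outCount N 6 e := by
  have hne : a ≠ a' := h.2.2.1
  by_cases hea : e = a
  · rw [hea]
    -- `e = a`: the class reordered as `(a'', a', e)`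
    exact inCount_five_le_outCount_six_of_seriesTriple_mem hn hR h'.symm h.symm haa''.symm
  by_cases hea' : e = a'
  · rw [hea']
    -- `e = a'`: the class reordered as `(a, a'', e)` via transitivity
    exact inCount_five_le_outCount_six_of_seriesTriple_mem hn hR (h.trans h' haa'') h'.symm hne
  by_cases hea'' : e = a''
  · rw [hea'']
    exact inCount_five_le_outCount_six_of_seriesTriple_mem hn hR h h' haa''
  exact inCount_five_le_outCount_six_of_seriesTriple hn hR h h' haa'' he hea hea' hea''

end TwelveSeriesD

end PercRepro.Cogirth
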